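import Summits.ResolutionOfSingularities.ResolutionOfSingularities.Theorems.EquisingularLiftEquisingularLiftNatCentreCodimTwo
import Summits.ResolutionOfSingularities.ResolutionOfSingularities.Theorems.EquisingularLiftEquisingularLiftNatStalkDimension
import Summits.ResolutionOfSingularities.ResolutionOfSingularities.Theorems.EquisingularLiftEquisingularLiftNatTowerRationalDefs
import Summits.ResolutionOfSingularities.ResolutionOfSingularities.Theorems.EquisingularLiftEquisingularLiftProjectiveAmbientSmoothProper
import Literature.AlgebraicGeometry.Morphisms.CechH1Projective
import Literature.AlgebraicGeometry.Motives.VarietiesProjectiveSpaceProofs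
import HarnessLib

/-!
# [OURS · L1 W4.5(b) · EL♮(3)] T-DIM-CENTRE, adapters — `hCframe` at the curve step in ONE call; the fibre datum on rational carriers
# (crux `EquisingularLiftNatThree` stmt-ResolutionOfSingularities-20148 / parent EL♮ stmt-…-20038; S1/S2 input (c))

NOT a statement of any manuscript. Helper file of the chain res-L1-w45b (cell `res-hironaka`, slot W4.5(b)); OURS; AI-written, weaker than
expert review; `--supports stmt-ResolutionOfSingularities-20148 --as helper` by res-L1-w45b-stub-3 g7. No `sorry`; standard axioms; no definitions.

WHAT (namespace `…Cruxes.EquisingularLiftNat.Sections`), on top of …NatCentreCodimTwo (T-DIM-CENTRE):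
* **`forall_exists_twoFrame_of_codim_over_closedPoint`** — for `r : X → Spec O` PROPER, `X` regular, `V(𝒞)` regular and the codimension
  clause only at the CLOSED points of `supp 𝒞` over the closed point of `O` — i.e. EXACTLY clause (v) of res-D-pv-029's `TCPlus.MemberKC`
  («`IsClosed {z} → dim (𝒪_{X,z} ⧸ (𝓢 ⊔ K)_z) + 2 = dim 𝒪_{X,z}` at the special points of the support») — the input `hCframe` of
  res-L1-w45b-stub-2's `DirLift.ruled_curveStep_root` holds on ALL of `supp 𝒞`. At the curve step this discharges S1 input (c) with NO
  further datum: `forall_exists_twoFrame_of_codim_over_closedPoint O (σ ≫ q) hXreg (𝓢 ⊔ K) hCreg (fun z hz hqz hzcl => (hv z hz hqz (by simp)).2 hzcl)`.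
* **`codim_two_of_iso_projectiveSpace_over`**, **`forall_exists_twoFrame_of_iso_projectiveSpace_over`** — centres `V(𝒞) ≅ ℙᵐ_O` OVER `O`
  (the CONCLUSION `∃ e₁ : 𝒞.subscheme ≅ ProjCech.PP O 1, e₁.hom ≫ ProjCech.toSpec O 1 = 𝒞.subschemeι ≫ σ ≫ q` of the roots' input (d) `hCrat`,
  and the direction centres `V(C₁) ≅ V(I) ≅ ℙ¹_O` of the rounds): the codimension clause at the closed points over the closed point from
  T-DIM alone (`𝒪_{X,x} ⧸ 𝒞_x ≅ 𝒪_{ℙᵐ_O, e₁ x}` has dimension `m + 1` there), hence `hCframe` on all of `supp 𝒞` over a proper stage — on a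
  RATIONAL root (where `hCrat` fires) the clause `hcodim` of N1 / S1 / S2 is thus FREE.
* **`ringKrullDim_stalk_eq_of_iso_projectiveSpace`**, **`ringKrullDim_stalk_eq_one_of_rationalCarrier`** — the fibre datum `hdimZ` of
  `forall_exists_twoFrame_of_model` on RATIONAL carriers: a scheme isomorphic to `ℙⁿ_{k'}` has `n`-dimensional local rings at its closed
  points (`RationalCarrier C` ⇒ `dim 𝒪_{C,c} = 1` at closed `c`), by T-DIM's `ringKrullDim_stalk_eq_of_smoothOfRelativeDimension_of_isClosed`
  (Görtz–Wedhorn I, Lemma 6.26) transported along the isomorphism; **`hdimZ_of_iso_projectiveLine`** = the `hdimZ` binder VERBATIM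
  (`d = 1`) from HSUB′(ReachNoseTower₃) v2's `hZP1 : Nonempty (redSub F₁ Z hZ ≅ (projectiveSpace 1 k).left)` (res-D-pv-018 / res-D-pv-035 N1′).

References: [cite: Matsumura1987, Thm. 14.2, Thm. 16.2]; [cite: StacksProject, Tag 01J7]; [cite: GortzWedhorn2020, Lemma 6.26]. Tree:
…NatCentreCodimTwo (this seat), …NatStalkDimension (res-D-pv-013, T-DIM), …NatTowerRationalDefs (`RationalCarrier`),
Literature `Motives.isSmoothProjective_projectiveSpace_holds`.
-/

set_option linter.dupNamespace false -- mandated namespace `Summit.<Summit>.<Problem>` of this single-conjunct summit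

noncomputable section

open CategoryTheory CategoryTheory.Limits AlgebraicGeometry TopologicalSpace Topology IsLocalRing
open Literature.AlgebraicGeometry.Resolution
open AlgebraicGeometry.Scheme.IdealSheafData
open Literature.AlgebraicGeometry.Morphisms (ProjCech.PP ProjCech.toSpec)
open Summit.ResolutionOfSingularities.ResolutionOfSingularities.Cruxes.EquisingularLift.StrataSplit

namespace Summit.ResolutionOfSingularities.ResolutionOfSingularities.Cruxes.EquisingularLiftNat.Sections

/-! ## The curve step: `hCframe` from clause (v) of the member, in one call -/

/-- **`hCframe` over a PROPER `X → Spec O` from the codimension clause at the closed points over the closed point.** For `r : X → Spec O`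
proper (`O` local), `X` regular, `𝒞` with `V(𝒞)` regular and `dim (𝒪_{X,z} ⧸ 𝒞_z) + 2 = dim 𝒪_{X,z}` at every CLOSED `z ∈ supp 𝒞` over the
closed point of `O` (clause (v) of `TCPlus.MemberKC`): every point of `supp 𝒞` carries a quasi-regular 2-frame of `𝒞` (`hCframe` verbatim).
Every closed point of the proper `X` lies over the closed point; then `forall_exists_twoFrame_of_isClosed` (generization, Stacks 01J7).
[cite: Matsumura1987, Thm. 14.2, Thm. 16.2] [cite: StacksProject, Tag 01J7] [OURS · L1 W4.5b] toward `stub_elnat_coneTowerPointResolution`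
(stmt-ResolutionOfSingularities-20148); NOT a statement of the manuscript. -/
theorem forall_exists_twoFrame_of_codim_over_closedPoint (O : Type) [CommRing O] [IsLocalRing O] {X : Scheme.{0}}
    (r : X ⟶ Spec (.of O)) [IsProper r] (hX : Scheme.IsRegular X) (𝒞 : X.IdealSheafData) (h𝒞 : Scheme.IsRegular 𝒞.subscheme)
    (hv : ∀ z ∈ 𝒞.support, r z = closedPoint O → IsClosed ({z} : Set X) →
      ringKrullDim (X.presheaf.stalk z ⧸ stalkIdeal 𝒞 z) + 2 = ringKrullDim (X.presheaf.stalk z)) :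
    ∀ x ∈ 𝒞.support, ∃ c : Fin 2 → X.presheaf.stalk x,
      Ideal.span (Set.range c) = stalkIdeal 𝒞 x ∧ IsQuasiRegular c := by
  obtain ⟨hc, hsp⟩ := compactSpace_and_apply_eq_closedPoint_of_isProper O r
  haveI := hc
  exact forall_exists_twoFrame_of_isClosed hX 𝒞 h𝒞 fun y hy hycl => hv y hy (hsp y hycl) hycl

/-- The `hcodim` form of the previous statement (for res-D-brk-4's `isRegularImmersionOfCodim_two_of_twoFrames`): over a proper
`X → Spec O`, the codimension clause at the closed points of `supp 𝒞` over the closed point gives it at every point of `supp 𝒞`.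
[cite: StacksProject, Tag 01J7] [OURS · L1 W4.5b]; NOT a statement of the manuscript. -/
theorem forall_codim_two_of_codim_over_closedPoint (O : Type) [CommRing O] [IsLocalRing O] {X : Scheme.{0}}
    (r : X ⟶ Spec (.of O)) [IsProper r] (hX : Scheme.IsRegular X) (𝒞 : X.IdealSheafData) (h𝒞 : Scheme.IsRegular 𝒞.subscheme)
    (hv : ∀ z ∈ 𝒞.support, r z = closedPoint O → IsClosed ({z} : Set X) →
      ringKrullDim (X.presheaf.stalk z ⧸ stalkIdeal 𝒞 z) + 2 = ringKrullDim (X.presheaf.stalk z)) :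
    ∀ x ∈ 𝒞.support, ringKrullDim (X.presheaf.stalk x ⧸ stalkIdeal 𝒞 x) + 2 = ringKrullDim (X.presheaf.stalk x) := by
  obtain ⟨hc, hsp⟩ := compactSpace_and_apply_eq_closedPoint_of_isProper O r
  haveI := hc
  exact forall_codim_of_isClosed hX 𝒞 h𝒞 fun y hy hycl => hv y hy (hsp y hycl) hycl

/-! ## The fibre datum on rational carriers -/

/-- **A scheme isomorphic to `ℙⁿ_{k'}` has `n`-dimensional local rings at its closed points** (Görtz–Wedhorn I, Lemma 6.26 for the
smooth `ℙⁿ_{k'} → Spec k'`, transported along the isomorphism). [cite: GortzWedhorn2020, Lemma 6.26] -/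
theorem ringKrullDim_stalk_eq_of_iso_projectiveSpace {k' : Type} [Field k'] (n : ℕ) {C : Scheme.{0}}
    (e : C ≅ (Literature.AlgebraicGeometry.Motives.projectiveSpace n k').left) (c : C) (hc : IsClosed ({c} : Set C)) :
    ringKrullDim (C.presheaf.stalk c) = (n : WithBot ℕ∞) := by
  haveI := (Literature.AlgebraicGeometry.Motives.isSmoothProjective_projectiveSpace_holds k' n).smoothOfRelativeDimension
  -- the image point is closed
  have hc' : IsClosed ({e.hom c} : Set ↥(Literature.AlgebraicGeometry.Motives.projectiveSpace n k').left) := by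
    have h := (Scheme.homeoOfIso e).isClosedMap _ hc
    rwa [Set.image_singleton] at h
  have h := ringKrullDim_stalk_eq_of_smoothOfRelativeDimension_of_isClosed
    (Literature.AlgebraicGeometry.Motives.projectiveSpace n k').hom n hc'
  rw [← h]
  exact ringKrullDim_eq_of_ringEquiv (asIso (e.hom.stalkMap c)).commRingCatIsoToRingEquiv.symm

/-- **On a RATIONAL carrier the local rings at closed points are `1`-dimensional**: `RationalCarrier C` (`C ≅ ℙ¹_{k'}` for some field
`k'`) ⇒ `dim 𝒪_{C,c} = 1` at every closed `c` — the fibre datum `hdimZ` (`d = 1`) of `forall_exists_twoFrame_of_model` for the reduced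
carrier curve `Z̃₉ = redSub F₉ Z₉ hZ₉` of a rational tower, or for a section `Z̃ ≅ Z̃₉`. [cite: GortzWedhorn2020, Lemma 6.26] [OURS · L1 W4.5b];
NOT a statement of the manuscript. -/
theorem ringKrullDim_stalk_eq_one_of_rationalCarrier {C : Scheme.{0}} (hC : RationalCarrier C) (c : C)
    (hc : IsClosed ({c} : Set C)) : ringKrullDim (C.presheaf.stalk c) = ((1 : ℕ) : WithBot ℕ∞) := by
  obtain ⟨k', _, ⟨e⟩⟩ := hC
  exact ringKrullDim_stalk_eq_of_iso_projectiveSpace 1 e c hc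

/-! ## Centres isomorphic to `ℙᵐ_O` over `O` (the conclusion of `hCrat`): the codimension clause at the closed points -/

/-- **A centre `V(𝒞) ≅ ℙᵐ_O` over `O` has codimension `2` at the closed points over the closed point of an ambient with
`(m + 3)`-dimensional local rings there.** For `r : X → Spec O` over a DVR, `𝒞` with an `O`-isomorphism `e₁ : V(𝒞) ≅ ℙᵐ_O`
(`e₁ ≫ toSpec = ι ≫ r` — the conclusion of the roots' input `hCrat`, `m = 1`), a CLOSED point `x ∈ supp 𝒞` over the closed point with
`dim 𝒪_{X,x} = n + 1` (T-DIM) and `n = m + 2`: `dim (𝒪_{X,x} ⧸ 𝒞_x) + 2 = dim 𝒪_{X,x}` (`𝒪_{X,x} ⧸ 𝒞_x ≅ 𝒪_{V(𝒞)} ≅ 𝒪_{ℙᵐ_O, e₁ x}`, of dimension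
`m + 1` at a closed point of the special fibre of the smooth `ℙᵐ_O → Spec O`, tree `ringKrullDim_stalk_eq_succ_of_smoothOfRelativeDimension`).
[cite: GrothendieckDieudonne1965, Cor. (6.1.2), p. 135] [cite: GortzWedhorn2020, Lemma 6.26] [OURS · L1 W4.5b]; NOT a statement of the manuscript. -/
theorem codim_two_of_iso_projectiveSpace_over (O : Type) [CommRing O] [IsDomain O] [IsDiscreteValuationRing O] {X : Scheme.{0}}
    (r : X ⟶ Spec (.of O)) (𝒞 : X.IdealSheafData) {m : ℕ} (e₁ : 𝒞.subscheme ≅ ProjCech.PP O m)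
    (he₁ : e₁.hom ≫ ProjCech.toSpec O m = 𝒞.subschemeι ≫ r) {x : X} (hx : x ∈ 𝒞.support) (hxcl : IsClosed ({x} : Set X))
    (hrx : r x = closedPoint O) {n : ℕ} (hnm : n = m + 2)
    (hdimX : ringKrullDim (X.presheaf.stalk x) = ((n + 1 : ℕ) : WithBot ℕ∞)) :
    ringKrullDim (X.presheaf.stalk x ⧸ stalkIdeal 𝒞 x) + 2 = ringKrullDim (X.presheaf.stalk x) := by
  haveI : SmoothOfRelativeDimension m (ProjCech.toSpec O m) := smoothOfRelativeDimension_toSpecZero_specMap m O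
  -- the point of `V(𝒞)` over `x`, closed, and its image in `ℙᵐ_O`, closed and over the closed point
  have hx' : x ∈ Set.range 𝒞.subschemeι := by rw [Scheme.IdealSheafData.range_subschemeι]; exact hx
  obtain ⟨s, rfl⟩ := hx'
  have hscl : IsClosed ({s} : Set ↥𝒞.subscheme) := by
    have hpre : (𝒞.subschemeι : ↥𝒞.subscheme → X) ⁻¹' {𝒞.subschemeι s} = {s} := by
      ext w
      simp only [Set.mem_preimage, Set.mem_singleton_iff]
      exact ⟨fun h => 𝒞.subschemeι.isClosedEmbedding.injective h, fun h => by rw [h]⟩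
    rw [← hpre]
    exact hxcl.preimage 𝒞.subschemeι.continuous
  have hecl : IsClosed ({e₁.hom s} : Set ↥(ProjCech.PP O m)) := by
    have h := (Scheme.homeoOfIso e₁).isClosedMap _ hscl
    rwa [Set.image_singleton] at h
  have hes : ProjCech.toSpec O m (e₁.hom s) = closedPoint O := by
    rw [← Scheme.Hom.comp_apply, he₁, Scheme.Hom.comp_apply]
    exact hrx
  -- `dim 𝒪_{X,x} ⧸ 𝒞_x = dim 𝒪_{V(𝒞),s} = dim 𝒪_{ℙᵐ_O, e₁ s} = m + 1`
  have h1 : ringKrullDim (X.presheaf.stalk (𝒞.subschemeι s) ⧸ stalkIdeal 𝒞 (𝒞.subschemeι s)) =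
      ringKrullDim (𝒞.subscheme.presheaf.stalk s) := by
    rw [← ker_stalkMap_subschemeι_eq_stalkIdeal]
    exact ringKrullDim_quotient_ker_stalkMap 𝒞.subschemeι s
  have h2 : ringKrullDim (𝒞.subscheme.presheaf.stalk s) = ringKrullDim ((ProjCech.PP O m).presheaf.stalk (e₁.hom s)) :=
    ringKrullDim_eq_of_ringEquiv (asIso (e₁.hom.stalkMap s)).commRingCatIsoToRingEquiv.symm
  have h3 := ringKrullDim_stalk_eq_succ_of_smoothOfRelativeDimension (ProjCech.toSpec O m) m hecl hes
  rw [h1, h2, h3, hdimX, hnm]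
  norm_cast

/-- **`hCframe` for a centre `≅ ℙᵐ_O` over a PROPER stage** — the rational case of the tower roots in ONE call: for `r : X → Spec O`
proper over a DVR, `X` regular with `dim 𝒪_{X,x} = n + 1` at its closed points in `supp 𝒞` over the closed point (T-DIM, tree
`ringKrullDim_stalk_eq_succ_of_chain`), `𝒞` with `V(𝒞)` regular and `O`-isomorphic to `ℙᵐ_O` (the conclusion of `hCrat`, `m = 1`),
`n = m + 2`: every point of `supp 𝒞` carries a quasi-regular 2-frame of `𝒞`. [cite: Matsumura1987, Thm. 14.2, Thm. 16.2]
[cite: StacksProject, Tag 01J7] [OURS · L1 W4.5b] toward `stub_elnat_coneTowerPointResolution` (stmt-ResolutionOfSingularities-20148);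
NOT a statement of the manuscript. -/
theorem forall_exists_twoFrame_of_iso_projectiveSpace_over (O : Type) [CommRing O] [IsDomain O] [IsDiscreteValuationRing O]
    {X : Scheme.{0}} (r : X ⟶ Spec (.of O)) [IsProper r] (hX : Scheme.IsRegular X) (𝒞 : X.IdealSheafData)
    (h𝒞 : Scheme.IsRegular 𝒞.subscheme) {m : ℕ} (e₁ : 𝒞.subscheme ≅ ProjCech.PP O m)
    (he₁ : e₁.hom ≫ ProjCech.toSpec O m = 𝒞.subschemeι ≫ r) {n : ℕ} (hnm : n = m + 2)
    (hdimX : ∀ x ∈ 𝒞.support, IsClosed ({x} : Set X) → r x = closedPoint O →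
      ringKrullDim (X.presheaf.stalk x) = ((n + 1 : ℕ) : WithBot ℕ∞)) :
    ∀ x ∈ 𝒞.support, ∃ c : Fin 2 → X.presheaf.stalk x,
      Ideal.span (Set.range c) = stalkIdeal 𝒞 x ∧ IsQuasiRegular c :=
  forall_exists_twoFrame_of_codim_over_closedPoint O r hX 𝒞 h𝒞 fun z hz hrz hzcl =>
    codim_two_of_iso_projectiveSpace_over O r 𝒞 e₁ he₁ hz hzcl hrz hnm (hdimX z hz hzcl hrz)

/-- **`hdimZ` of `forall_exists_twoFrame_of_model` / of res-D-pv-035's N1′ `DirLift.ruled_noseRoot_of_dimZ`, from `Z̃ ≅ ℙ¹_{k'}`** (the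
binder `hZP1 : Nonempty (redSub F₁ Z hZ ≅ (projectiveSpace 1 k).left)` of HSUB′(ReachNoseTower₃) v2, res-L1-w45b-plan-1 RULING
2026-08-27T20:45:53Z; `redSub F Z hZ = (vanishingIdeal ⟨Z, hZ⟩).subscheme`): at every closed point `z` of `Z̃` one has `dim 𝒪_{Z̃,z} = 1`
(the second closedness clause of the binder is not used). [cite: GortzWedhorn2020, Lemma 6.26] [OURS · L1 W4.5b]; NOT a statement of the manuscript. -/
theorem hdimZ_of_iso_projectiveLine {k' : Type} [Field k'] {F X' : Scheme.{0}} (j : F ⟶ X') (Z : Set F) (hZ : IsClosed Z)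
    (hZP1 : Nonempty ((vanishingIdeal (⟨Z, hZ⟩ : Closeds F)).subscheme ≅
      (Literature.AlgebraicGeometry.Motives.projectiveSpace 1 k').left)) :
    ∀ z : ↥(vanishingIdeal (⟨Z, hZ⟩ : Closeds F)).subscheme,
      IsClosed ({z} : Set ↥(vanishingIdeal (⟨Z, hZ⟩ : Closeds F)).subscheme) →
      IsClosed ({j ((vanishingIdeal (⟨Z, hZ⟩ : Closeds F)).subschemeι z)} : Set X') →
      ringKrullDim ((vanishingIdeal (⟨Z, hZ⟩ : Closeds F)).subscheme.presheaf.stalk z) = ((1 : ℕ) : WithBot ℕ∞) := by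
  obtain ⟨e⟩ := hZP1
  exact fun z hz _ => ringKrullDim_stalk_eq_of_iso_projectiveSpace 1 e z hz

end Summit.ResolutionOfSingularities.ResolutionOfSingularities.Cruxes.EquisingularLiftNat.Sections

end
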